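import Mathlib
import HarnessLib
import Literature.NumberTheory.Transcendental.KZCalculus
import Literature.NumberTheory.Transcendental.KZLogCalculusProofs
import Literature.NumberTheory.Transcendental.KZHomotopyMoves
import Literature.NumberTheory.Transcendental.KZUnfoldedStokesProofs
import Literature.NumberTheory.Transcendental.SemialgebraicLineDeriv
import Summits.KontsevichZagierPeriods.KontsevichZagierPeriods.Theorems.LinRedNormalFormDihedralNormalFormStubBoundedStokesMove
import Summits.KontsevichZagierPeriods.KontsevichZagierPeriods.Theorems.LinRedNormalFormDihedralNormalFormStubExactToFacesTwoAux3
import Summits.KontsevichZagierPeriods.KontsevichZagierPeriods.Theorems.LinRedNormalFormDihedralNormalFormStubExactToFacesTwoAux4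

/-!
# Stub `stub_exactToFacesTwo` of line `tame-bv-stokes` (crux `DihedralNormalForm`)

DIMENSION TWO of the descent of cubical representations. A convergent cubical representation of
dimension two is `[□², q x₀^{a₀} x₁^{a₁} (1-x₀)^{e₀₀} (1-x₀x₁)^{e₀₁} (1-x₁)^{e₁₁}]` (integer
exponents) on the open square. CLAIM: given Stokes on the open cube for bounded semialgebraic
primitives (the hypothesis `hStokes`, verbatim the landed `stub_boundedStokesMove`), it lies in
`KZ.relations ⊔ ⟨LogRep 2 ∪ CubRep 1⟩`, where `LogRep 2 ∋ [Δ₂, q/(t₀(1-t₁))]` (the `ζ(2)` word)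
and `CubRep 1` are the cubical atoms `[(0,1), q y^a (1-y)^e]` of dimension one.

Proof (tools I–IV in the files `…StubExactToFacesTwoAux*.lean`; `w = 1 - x₀x₁`, pole order
`s = -e₀₁`, `GEN(k, a, b, P, R, m) = k x₀^a x₁^b (1-x₀)^P (1-x₁)^R w^m`):

* `q = 0`: zero integrand, a relation. `q ≠ 0`: absolute convergence forces `a₀, a₁, e₀₀, e₁₁ ≥ 0`
  and `s ≤ e₀₀ + e₁₁ + 1` (tools III, `facesTwo_exponents`), so the integrand is
  `GEN(q, a, b, P, R, m)` with `a b P R ∈ ℕ`, `m ≥ -(P+R+1)`; every such function is absolutely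
  integrable (`|GEN| ≤ |q|/w`), so all intermediate atoms below are honest integral
  representations (tools I).
* `m ≥ 0` (polynomial): induction on `m + P`, one Stokes move in direction `x₀` per step
  (tools IV, `facesTwo_good_poly`); faces are rational polynomials in one variable, i.e. sums of
  cubical atoms of dimension one (tools II).
* `m = -1`: binomial identities reduce to `W(a,b) = q x₀^a x₁^b/w`, then `x₀x₁ = 1 - w` to
  `T_c = q x₀^c/w`; `T_c`, `c ≥ 1`, is ONE Stokes move with the two bounded primitives
  `k x₀^c(1-x₀)/w`, `k x₀^{c-1}(1-x₁)/w` (`k = -q/c`) away from `T_{c-1}` and faces; `T₀ = q/w` is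
  the cubical chart of the `ζ(2)` word (tools IV).
* `m ≤ -2` (this file, `facesTwo_pole_step`): for `b ≥ 1` ONE Stokes move in direction `x₀` with
  the bounded primitive `h₀ = GEN(-q/(m+1), a, b-1, P, R, m+1)` (`|h₀| ≤ |q|/(s-1)` since
  `(1-x₀)^P(1-x₁)^R ≤ w^{P+R} ≤ w^{s-1}`), whose `x₀`-derivative is the atom plus two atoms of
  pole order `s - 1`; `b = 0 < a` by the symmetry `x₀ ↔ x₁`; `a = b = 0` by `1 = w + x₀x₁`.
  Induction on `s`.

References: M. Kontsevich, D. Zagier, *Periods* (2001), §1.2 (rules (1)–(3)); F. Brown,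
*Multiple zeta values and periods of moduli spaces* (2009), §2 (cubical coordinates).
-/

noncomputable section

open MeasureTheory Set
open Literature.NumberTheory.Transcendental
open Literature.ModelTheory.ExponentialFields (IsSemialgebraic)
open Summit.KontsevichZagierPeriods.MzvKernelInKZ.Negative
open Summit.KontsevichZagierPeriods.MzvKernelInKZ.TwoPosets

namespace Summit.KontsevichZagierPeriods.DihedralNormalForm.TameBVStokes

/-! ### The standing hypotheses (as in tools II and IV) -/

variable (hStokes : ∀ (k : ℕ) (h : Fin (k + 1) → (Fin (k + 1) → ℝ) → ℝ) (C : ℝ)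
    (r : Literature.NumberTheory.Transcendental.KZ.IntegralRep (k + 1))
    (f₀ f₁ : Fin (k + 1) → Literature.NumberTheory.Transcendental.KZ.IntegralRep k),
    (∀ i, Literature.NumberTheory.Transcendental.IsSemialgebraicFunOn ℚ
      {x : Fin (k + 1) → ℝ | ∀ i, x i ∈ Set.Icc (0:ℝ) 1} (h i)) →
    (∀ i, ∀ x ∈ {x : Fin (k + 1) → ℝ | ∀ i, x i ∈ Set.Ioo (0:ℝ) 1}, |h i x| ≤ C) →
    (∀ i, ∀ x ∈ {x : Fin (k + 1) → ℝ | ∀ i, x i ∈ Set.Ioo (0:ℝ) 1},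
      DifferentiableAt ℝ (h i) x) →
    (∀ i, ∀ y ∈ {x : Fin k → ℝ | ∀ i, x i ∈ Set.Ioo (0:ℝ) 1},
      ContinuousOn (fun t : ℝ => h i (Fin.insertNth i t y)) (Set.Icc 0 1)) →
    r.domain = {x : Fin (k + 1) → ℝ | ∀ i, x i ∈ Set.Ioo (0:ℝ) 1} →
    Set.EqOn r.integrand (fun x => ∑ i, fderiv ℝ (h i) x (Pi.single i 1)) r.domain →
    (∀ i, (f₀ i).domain = {x : Fin k → ℝ | ∀ i, x i ∈ Set.Ioo (0:ℝ) 1} ∧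
      (f₁ i).domain = {x : Fin k → ℝ | ∀ i, x i ∈ Set.Ioo (0:ℝ) 1} ∧
      Set.EqOn (f₀ i).integrand (fun y => h i (Fin.insertNth i 0 y))
        {x : Fin k → ℝ | ∀ i, x i ∈ Set.Ioo (0:ℝ) 1} ∧
      Set.EqOn (f₁ i).integrand (fun y => h i (Fin.insertNth i 1 y))
        {x : Fin k → ℝ | ∀ i, x i ∈ Set.Ioo (0:ℝ) 1}) →
    Literature.NumberTheory.Transcendental.KZ.of r -
        ∑ i, (Literature.NumberTheory.Transcendental.KZ.of (f₁ i) -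
          Literature.NumberTheory.Transcendental.KZ.of (f₀ i)) ∈
      Literature.NumberTheory.Transcendental.KZ.relations)
  {G : AddSubgroup KZ.FormalRep} (hG : KZ.relations ≤ G)
  (hC1 : ∀ (f : KZ.IntegralRep 1) (q : ℚ) (a e : ℕ), f.domain = KZ.unitCube 1 →
    Set.EqOn f.integrand (fun y => (q : ℝ) * (y 0 ^ a * (1 - y 0) ^ e)) (KZ.unitCube 1) →
    KZ.of f ∈ G)
  (hL : ∀ q : ℚ, KZ.of (wordRep ω2 q adm_ω2) ∈ G)

/-! ### Pole order at least two: the integration-by-parts step -/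

include hStokes hG hC1 in
/-- **The Stokes step lowering the pole order** (`m ≤ -2`, pole order `s = -m ≥ 2`). Assume all
atoms of pole order `s - 1` are GOOD. For `b ≥ 1`, ONE Stokes move in direction `x₀` with the
primitive `h₀ = GEN(-q/(m+1), a, b-1, P, R, m+1)` (bounded on the closed square because
`P + R + m + 1 ≥ 0`; the face `x₀ = 1` is a polynomial because `P ≥ 1` or `R + m + 1 ≥ 0`):
`∂₀h₀ = GEN(q, a, b, P, R, m) + (two atoms of pole order s - 1)`. For `b = 0 < a` use the
symmetry `x₀ ↔ x₁`; for `a = b = 0` split `1 = (1 - x₀x₁) + x₀x₁`.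
[cite: KontsevichZagier2001, §1.2 rule (3)] -/
theorem facesTwo_pole_step (m : ℤ) (hm : m ≤ -2)
    (ih : ∀ (a b P R : ℕ) (q : ℚ), -((P : ℤ) + R + 1) ≤ m + 1 →
      ∀ r : KZ.IntegralRep 2, r.domain = KZ.unitCube 2 → Set.EqOn r.integrand (fun x => (q : ℝ) *
        (x 0 ^ a * x 1 ^ b * (1 - x 0) ^ P * (1 - x 1) ^ R * (1 - x 0 * x 1) ^ (m + 1)))
        (KZ.unitCube 2) → KZ.of r ∈ G) :
    ∀ (a b P R : ℕ) (q : ℚ), -((P : ℤ) + R + 1) ≤ m →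
      ∀ r : KZ.IntegralRep 2, r.domain = KZ.unitCube 2 → Set.EqOn r.integrand (fun x => (q : ℝ) *
        (x 0 ^ a * x 1 ^ b * (1 - x 0) ^ P * (1 - x 1) ^ R * (1 - x 0 * x 1) ^ m)) (KZ.unitCube 2) →
        KZ.of r ∈ G := by
  have hm1 : (m : ℝ) + 1 ≠ 0 := by
    have : (m : ℝ) ≤ -2 := by exact_mod_cast hm
    intro h
    linarith
  -- `b ≥ 1`: the Stokes move in direction `x₀`
  have hB : ∀ (a b P R : ℕ) (q : ℚ), 1 ≤ b → -((P : ℤ) + R + 1) ≤ m →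
      ∀ r : KZ.IntegralRep 2, r.domain = KZ.unitCube 2 → Set.EqOn r.integrand (fun x => (q : ℝ) *
        (x 0 ^ a * x 1 ^ b * (1 - x 0) ^ P * (1 - x 1) ^ R * (1 - x 0 * x 1) ^ m)) (KZ.unitCube 2) →
        KZ.of r ∈ G := by
    intro a b P R q hb hgood
    obtain ⟨r, hrd, hri⟩ := facesTwo_rep_sub (facesTwo_rep_add (facesTwo_rep_gen q a b P R m hgood)
      (facesTwo_rep_gen (-q / ((m : ℚ) + 1) * a) (a - 1) (b - 1) P R (m + 1) (by omega)))
      (facesTwo_rep_gen (-q / ((m : ℚ) + 1) * P) a (b - 1) (P - 1) R (m + 1) (by omega))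
    have hr : KZ.of r ∈ G := by
      refine facesTwo_stokes hStokes hG hC1 (-q / ((m : ℚ) + 1)) a (b - 1) P R (m + 1) 0 0 0 0 0 0
        (by omega) (by norm_num) ?_ (Or.inr (by norm_num)) r hrd fun x hx => ?_
      · rcases Nat.eq_zero_or_pos P with rfl | hP
        · exact Or.inr (by omega)
        · exact Or.inl hP
      · rw [hri hx]
        have hw : 1 - x 0 * x 1 ≠ 0 := (facesTwo_w_pos hx).ne'
        rw [Nat.sub_add_cancel hb, add_sub_cancel_right]
        push_cast
        field_simp
        ring
    have hd := facesTwo_good_congr hG hrd hri hr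
    refine facesTwo_good_add3 hG hd (ih (a - 1) (b - 1) P R (-(-q / ((m : ℚ) + 1) * a)) (by omega))
      (ih a (b - 1) (P - 1) R (-q / ((m : ℚ) + 1) * P) (by omega)) ⟨r, hrd, hri⟩
      (facesTwo_rep_gen _ _ _ _ _ _ (by omega)) (facesTwo_rep_gen _ _ _ _ _ _ (by omega))
      fun x _ => ?_
    push_cast
    ring
  intro a b P R q hgood
  rcases Nat.eq_zero_or_pos b with rfl | hb
  · rcases Nat.eq_zero_or_pos a with rfl | ha
    · -- `a = b = 0`: split `1 = (1 - x₀x₁) + x₀x₁`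
      refine facesTwo_good_add hG (ih 0 0 P R q (by omega)) (hB 1 1 P R q le_rfl hgood)
        (facesTwo_rep_gen _ _ _ _ _ _ (by omega)) (facesTwo_rep_gen _ _ _ _ _ _ hgood)
        fun x hx => ?_
      have hw : 1 - x 0 * x 1 ≠ 0 := (facesTwo_w_pos hx).ne'
      rw [zpow_add_one₀ hw]
      ring
    · -- `b = 0 < a`: symmetry
      exact facesTwo_good_swap hG q 0 a R P m (hB 0 a R P q ha (by omega))
  · exact hB a b P R q hb hgood

include hStokes hG hC1 hL in
/-- **All atoms of negative `m` are GOOD**: induction on the pole order, from pole order one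
(tools IV, `facesTwo_good_m1`) by `facesTwo_pole_step`. -/
theorem facesTwo_good_negm : ∀ (n : ℕ) (m : ℤ), m = -((n : ℤ) + 1) → ∀ (a b P R : ℕ) (q : ℚ),
    -((P : ℤ) + R + 1) ≤ m →
      ∀ r : KZ.IntegralRep 2, r.domain = KZ.unitCube 2 → Set.EqOn r.integrand (fun x => (q : ℝ) *
        (x 0 ^ a * x 1 ^ b * (1 - x 0) ^ P * (1 - x 1) ^ R * (1 - x 0 * x 1) ^ m)) (KZ.unitCube 2) →
        KZ.of r ∈ G := by
  intro n
  induction n with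
  | zero =>
    intro m hm a b P R q _
    have hm' : m = -1 := by rw [hm]; norm_num
    subst hm'
    exact facesTwo_good_m1 hStokes hG hC1 hL P R a b q
  | succ n ih =>
    intro m hm
    refine facesTwo_pole_step hStokes hG hC1 m (by rw [hm]; push_cast; omega) ?_
    exact ih (m + 1) (by rw [hm]; push_cast; ring)

include hStokes hG hC1 hL in
/-- **Every atom `GEN(q, a, b, P, R, m)` with `m ≥ -(P + R + 1)` is GOOD.** -/
theorem facesTwo_good_all (q : ℚ) (a b P R : ℕ) (m : ℤ) (hm : -((P : ℤ) + R + 1) ≤ m) :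
    ∀ r : KZ.IntegralRep 2, r.domain = KZ.unitCube 2 → Set.EqOn r.integrand (fun x => (q : ℝ) *
      (x 0 ^ a * x 1 ^ b * (1 - x 0) ^ P * (1 - x 1) ^ R * (1 - x 0 * x 1) ^ m)) (KZ.unitCube 2) →
      KZ.of r ∈ G := by
  rcases le_or_gt 0 m with hm0 | hm0
  · exact facesTwo_good_nonneg hStokes hG hC1 m hm0 a b P R q
  · obtain ⟨n, hn⟩ := Int.eq_negSucc_of_lt_zero hm0
    rw [Int.negSucc_eq] at hn
    exact facesTwo_good_negm hStokes hG hC1 hL n m hn a b P R q hm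

/-! ### The stub -/

/-- The cubical integrand of dimension two, with the `Fin 2` products evaluated: the chords are
`x₀`, `x₀x₁`, `x₁`. -/
theorem facesTwo_cubRep_two_integrand (q : ℚ) (a : Fin 2 → ℤ) (e : Fin 2 → Fin 2 → ℤ)
    (x : Fin 2 → ℝ) :
    (q : ℝ) * ((∏ i, x i ^ a i) * ∏ i, ∏ j, if i ≤ j then
      (1 - ∏ l, if i ≤ l ∧ l ≤ j then x l else 1) ^ e i j else 1) =
    (q : ℝ) * (x 0 ^ a 0 * x 1 ^ a 1 * (1 - x 0) ^ e 0 0 * (1 - x 1) ^ e 1 1 *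
      (1 - x 0 * x 1) ^ e 0 1) := by
  congr 1
  simp [Fin.prod_univ_two]
  ring

/-- **`stub_exactToFacesTwo`** (line `tame-bv-stokes`, crux `DihedralNormalForm`). DIMENSION TWO:
given Stokes on the open cube for bounded semialgebraic primitives (the hypothesis, verbatim the
landed `stub_boundedStokesMove`), every convergent cubical representation of dimension two lies in
`KZ.relations ⊔ ⟨LogRep 2 ∪ CubRep 1⟩`. Zero coefficient: a relation. Otherwise absolute
convergence forces the exponents (`facesTwo_exponents`), the integrand is
`GEN(q, a, b, P, R, m)` with `m ≥ -(P + R + 1)` on the open square, and `facesTwo_good_all`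
(polynomial case, pole order one via the `T_c`-recursion and the cubical chart to the `ζ(2)` word,
higher pole order by the integration-by-parts Stokes step) applies, with `G` the target subgroup:
it contains the relations, the cubical atoms of dimension one and the `ζ(2)` words
`[Δ₂, q/(t₀(1-t₁))] ∈ LogRep 2` (coefficient `-q` on the map `(0 ↦ letter 0, 1 ↦ letter 1)`).
[cite: KontsevichZagier2001, §1.2] -/
theorem stub_exactToFacesTwo (CubRep : ℕ → Set Literature.NumberTheory.Transcendental.KZ.FormalRep) (hCubRep : ∀ k, CubRep k = {y : Literature.NumberTheory.Transcendental.KZ.FormalRep | ∃ (q : ℚ) (a : Fin k → ℤ) (e : Fin k → Fin k → ℤ) (s : Literature.NumberTheory.Transcendental.KZ.IntegralRep k), s.domain = {x : Fin k → ℝ | ∀ i, x i ∈ Set.Ioo (0:ℝ) 1} ∧ Set.EqOn s.integrand (fun x => (q : ℝ) * ((∏ i, x i ^ a i) * ∏ i, ∏ j, if i ≤ j then (1 - ∏ l, if i ≤ l ∧ l ≤ j then x l else 1) ^ e i j else 1)) s.domain ∧ y = Literature.NumberTheory.Transcendental.KZ.of s}) (LogRep : ℕ → Set Literature.NumberTheory.Transcendental.KZ.FormalRep)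 (hLogRep : ∀ ℓ, LogRep ℓ = {y : Literature.NumberTheory.Transcendental.KZ.FormalRep | ∃ (q : (Fin ℓ → Fin (ℓ + 2)) → ℚ) (s : Literature.NumberTheory.Transcendental.KZ.IntegralRep ℓ), s.domain = {t : Fin ℓ → ℝ | (∀ i, 0 < t i) ∧ (∀ i, t i < 1) ∧ StrictAnti t} ∧ Set.EqOn s.integrand (fun t => ∑ f : Fin ℓ → Fin (ℓ + 2), (q f : ℝ) * ∏ i : Fin ℓ, 1 / (t i - (if ((f i : Fin (ℓ + 2)) : ℕ) = 0 then (0:ℝ) else if ((f i : Fin (ℓ + 2)) : ℕ) = 1 then 1 else if h : ((f i : Fin (ℓ + 2)) : ℕ) - 2 < (i : ℕ) then t ⟨((f i : Fin (ℓ + 2)) : ℕ) - 2, lt_trans h i.isLt⟩ else 0))) s.domain ∧ y = Literature.NumberTheory.Transcendental.KZ.of s}) : (∀ (k : ℕ) (h : Fin (k + 1) → (Fin (k + 1) → ℝ) → ℝ) (C : ℝ) (r : Literature.NumberTheory.Transcendental.KZ.IntegralRep (k + 1)) (f₀ f₁ : Fin (k + 1) → Literature.NumberTheory.Transcendental.KZ.IntegralRep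 k), (∀ i, Literature.NumberTheory.Transcendental.IsSemialgebraicFunOn ℚ {x : Fin (k + 1) → ℝ | ∀ i, x i ∈ Set.Icc (0:ℝ) 1} (h i)) → (∀ i, ∀ x ∈ {x : Fin (k + 1) → ℝ | ∀ i, x i ∈ Set.Ioo (0:ℝ) 1}, |h i x| ≤ C) → (∀ i, ∀ x ∈ {x : Fin (k + 1) → ℝ | ∀ i, x i ∈ Set.Ioo (0:ℝ) 1}, DifferentiableAt ℝ (h i) x) → (∀ i, ∀ y ∈ {x : Fin k → ℝ | ∀ i, x i ∈ Set.Ioo (0:ℝ) 1}, ContinuousOn (fun t : ℝ => h i (Fin.insertNth i t y)) (Set.Icc 0 1)) → r.domain = {x : Fin (k + 1) → ℝ | ∀ i, x i ∈ Set.Ioo (0:ℝ) 1} → Set.EqOn r.integrand (fun x => ∑ i, fderiv ℝ (h i) x (Pi.single i 1)) r.domain → (∀ i, (f₀ i).domain = {x : Fin k → ℝ | ∀ i, x i ∈ Set.Ioo (0:ℝ) 1} ∧ (f₁ i).domain = {x : Fin k → ℝ | ∀ i, x i ∈ Set.Ioo (0:ℝ) 1} ∧ Set.EqOn (f₀ i).integrand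 (fun y => h i (Fin.insertNth i 0 y)) {x : Fin k → ℝ | ∀ i, x i ∈ Set.Ioo (0:ℝ) 1} ∧ Set.EqOn (f₁ i).integrand (fun y => h i (Fin.insertNth i 1 y)) {x : Fin k → ℝ | ∀ i, x i ∈ Set.Ioo (0:ℝ) 1}) → Literature.NumberTheory.Transcendental.KZ.of r - ∑ i, (Literature.NumberTheory.Transcendental.KZ.of (f₁ i) - Literature.NumberTheory.Transcendental.KZ.of (f₀ i)) ∈ Literature.NumberTheory.Transcendental.KZ.relations) → ∀ y ∈ CubRep 2, y ∈ Literature.NumberTheory.Transcendental.KZ.relations ⊔ AddSubgroup.closure (LogRep 2 ∪ CubRep 1) := by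
  intro hStokes y hy
  -- the target subgroup contains the relations, `CubRep 1` and the `ζ(2)` words of `LogRep 2`
  have hG : KZ.relations ≤ KZ.relations ⊔ AddSubgroup.closure (LogRep 2 ∪ CubRep 1) := le_sup_left
  have hC1 : ∀ (f : KZ.IntegralRep 1) (q : ℚ) (a e : ℕ), f.domain = KZ.unitCube 1 →
      Set.EqOn f.integrand (fun y => (q : ℝ) * (y 0 ^ a * (1 - y 0) ^ e)) (KZ.unitCube 1) →
      KZ.of f ∈ KZ.relations ⊔ AddSubgroup.closure (LogRep 2 ∪ CubRep 1) := by
    intro f q' a' e' hfd hfi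
    refine (le_sup_right : AddSubgroup.closure (LogRep 2 ∪ CubRep 1) ≤ _)
      (AddSubgroup.subset_closure (Or.inr ?_))
    rw [hCubRep]
    refine ⟨q', fun _ => (a' : ℤ), fun _ _ => (e' : ℤ), f, hfd, fun y hy => ?_, rfl⟩
    rw [hfd] at hy
    rw [hfi hy]
    simp [zpow_natCast]
  have hL : ∀ q' : ℚ, KZ.of (wordRep ω2 q' adm_ω2) ∈
      KZ.relations ⊔ AddSubgroup.closure (LogRep 2 ∪ CubRep 1) := by
    intro q'
    refine (le_sup_right : AddSubgroup.closure (LogRep 2 ∪ CubRep 1) ≤ _)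
      (AddSubgroup.subset_closure (Or.inl ?_))
    rw [hLogRep]
    refine ⟨fun f => if f = ![0, 1] then -q' else 0, wordRep ω2 q' adm_ω2, rfl, fun t ht => ?_, rfl⟩
    have ht0 : 0 < t 0 := ht.1 0
    have ht1 : t 1 < 1 := ht.2.1 1
    have h1 : (1 : ℝ) - t 1 ≠ 0 := by intro h; linarith
    have h2 : t 1 - 1 ≠ 0 := by intro h; linarith
    show wordFun ω2 q' t = _
    beta_reduce
    rw [Finset.sum_eq_single (![0, 1] : Fin 2 → Fin 4)]
    · simp [wordFun, Summit.KontsevichZagierPeriods.MzvKernelInKZ.Negative.ω2, Fin.prod_univ_two]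
      field_simp
      ring
    · intro f _ hf
      simp [hf]
    · exact fun h => absurd (Finset.mem_univ _) h
  -- the given cubical representation
  rw [hCubRep] at hy
  obtain ⟨q, a, e, s, hdom, hint, rfl⟩ := hy
  have hint2 : EqOn s.integrand (fun x => (q : ℝ) * (x 0 ^ a 0 * x 1 ^ a 1 * (1 - x 0) ^ e 0 0 *
      (1 - x 1) ^ e 1 1 * (1 - x 0 * x 1) ^ e 0 1)) (KZ.unitCube 2) := by
    intro x hx
    rw [hint (by rw [hdom]; exact hx)]
    exact facesTwo_cubRep_two_integrand q a e x
  by_cases hq : q = 0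
  · refine hG (KZ.of_mem_relations_of_eqOn_zero s fun x hx => ?_)
    rw [hdom] at hx
    rw [hint2 hx]
    simp [hq]
  -- `q ≠ 0`: absolute convergence forces the exponents
  obtain ⟨ha0, ha1, he00, he11, he01⟩ := facesTwo_exponents q hq _ _ _ _ _ s hdom hint2
  obtain ⟨A, hA⟩ := Int.eq_ofNat_of_zero_le ha0
  obtain ⟨B, hB⟩ := Int.eq_ofNat_of_zero_le ha1
  obtain ⟨P, hP⟩ := Int.eq_ofNat_of_zero_le he00
  obtain ⟨R, hR⟩ := Int.eq_ofNat_of_zero_le he11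
  rw [hP, hR] at he01
  refine facesTwo_good_all hStokes hG hC1 hL q A B P R (e 0 1) he01 s hdom fun x hx => ?_
  rw [hint2 hx]
  simp only [hA, hB, hP, hR, zpow_natCast]

end Summit.KontsevichZagierPeriods.DihedralNormalForm.TameBVStokes
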